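import Summits.QuantumFields.QCD.Theses.HeatSlicedQuarks
import Literature.MathematicalPhysics.QuantumLattice.OverlapLocality

/-!
# `ActionBoundsLowModes` (crux stmt-QuantumFields-8872, route HeatSlicedQuarks): load-bearing terms
# and tightness of the constant (negative-side support, cdisprove seat)

The crux: `∃ C, ∀ L U m ∈ [−1/2,1] λ ≥ 0 E`, (`‖D_W(U,m,1)v‖² ≤ λ‖v‖²` on `E`) →
`dim E ≤ C(λ²L⁴ + S_W(U) + 1)`.  Proved here, sorry-free, all on the trivial configuration `U ≡ 1`:

* `wilsonDirac_trivialConfig_one` — on the `1⁴` torus `D_W(1, m, 1) = m • 1` (the Wilson term cancels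
  `4r`); `wilsonAction_trivialConfig` — `S_W(1) = 0`; `wilsonAction_nonneg` — `S_W ≥ 0` on `SU(3)`;
  `finrank_top_quarkFields` — `dim = 12L⁴`; `hyp_top_81` — the hypothesis holds on the whole space with
  `λ = 81` (`‖D_W(m)‖ ≤ |m+4| + 4 ≤ 9`, the tree's HJL bound `l2_opNorm_wilsonDirac_le`).
* `actionBoundsLowModes_false_without_one` — the variant WITHOUT the `+ 1` is false (12 constant zero
  modes at `m = 0`, `λ = 0`, `S_W = 0`): any proof must use the `+ 1`.
* `actionBoundsLowModes_false_without_weyl` — the variant WITHOUT `λ²L⁴` is false (`λ = 81`, whole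
  space, `S_W = 0`, `L > C`): any proof must use the Weyl term.
* `actionBoundsLowModes_twelve_le_const` — every admissible constant is `≥ 12`;
  `actionBoundsLowModes_false_of_const_lt_twelve`.

None of these refutes the crux; they fence it (see the crux work file
`Summits/QuantumFields/QCD/Cruxes/ActionBoundsLowModes/Disproof.lean` for the analysis of why it resists).
-/

open scoped Matrix.Norms.L2Operator
open Literature.MathematicalPhysics.QuantumLattice Literature.MathematicalPhysics.QuantumFieldTheory
open Literature.Probability.LatticeModels (TorusSite)

namespace Summit.QuantumFields.QCD.Theorems.ActionBoundsLowModes.Negative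

local notation "SU3" => Matrix.specialUnitaryGroup (Fin 3) ℂ
local notation "ρ₃" => fundamentalRep (Fin 3)

/-! ## The crux with its constant exposed -/

/-- The body of the crux `ActionBoundsLowModes` with its constant exposed (a definitional
unfolding, `actionBoundsLowModes_iff`); not a fact. -/
def ActionBoundsLowModesWith (C : ℝ) : Prop :=
  ∀ (L : ℕ) [NeZero L] (U : GaugeConfig 4 L SU3) (m : ℝ), m ∈ Set.Icc (-(1 / 2 : ℝ)) 1 →
    ∀ (lam : ℝ), 0 ≤ lam → ∀ (E : Submodule ℂ (TorusSite 4 L × Fin 3 × Fin 4 → ℂ)),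
      (∀ v ∈ E, ∑ i, ‖(wilsonDirac ρ₃ U m 1).mulVec v i‖ ^ 2 ≤ lam * ∑ i, ‖v i‖ ^ 2) →
        (Module.finrank ℂ E : ℝ) ≤ C * (lam ^ 2 * (L : ℝ) ^ 4 + wilsonAction ρ₃ U + 1)

/-- The crux is `∃ C, ActionBoundsLowModesWith C` (definitionally). -/
theorem actionBoundsLowModes_iff :
    Theses.HeatSlicedQuarks.ActionBoundsLowModes ↔ ∃ C, ActionBoundsLowModesWith C := Iff.rfl

/-- `Re tr g ≤ 3` on `SU(3)` (unitary entries have modulus `≤ 1`). -/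
theorem re_trace_fundamentalRep_le_three (g : SU3) : ((ρ₃ g).trace).re ≤ 3 := by
  have hU : (g : Matrix (Fin 3) (Fin 3) ℂ) ∈ Matrix.unitaryGroup (Fin 3) ℂ :=
    fundamentalRep_mem_unitaryGroup g
  rw [fundamentalRep_apply, Matrix.trace, Complex.re_sum]
  calc ∑ i, (Matrix.diag (g : Matrix (Fin 3) (Fin 3) ℂ) i).re ≤ ∑ _i : Fin 3, (1 : ℝ) :=
        Finset.sum_le_sum fun i _ =>
          ((le_abs_self _).trans (Complex.abs_re_le_norm _)).trans (entry_norm_bound_of_unitary hU i i)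
    _ = 3 := by simp

/-- The tree's Wilson action of an `SU(3)` field is non-negative. -/
theorem wilsonAction_nonneg (L : ℕ) [NeZero L] (U : GaugeConfig 4 L SU3) :
    0 ≤ wilsonAction ρ₃ U := by
  unfold wilsonAction
  refine Finset.sum_nonneg fun p _ => ?_
  push_cast
  linarith [re_trace_fundamentalRep_le_three (plaquetteHolonomy U p.1 p.2.1.1 p.2.1.2)]

/-- Monotonicity in the constant. -/
theorem ActionBoundsLowModesWith.mono {C C' : ℝ} (h : ActionBoundsLowModesWith C) (hCC' : C ≤ C') :
    ActionBoundsLowModesWith C' := by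
  intro L _ U m hm lam hlam E hE
  refine (h L U m hm lam hlam E hE).trans ?_
  have h0 : 0 ≤ lam ^ 2 * (L : ℝ) ^ 4 + wilsonAction ρ₃ U + 1 := by
    have hS := wilsonAction_nonneg L U
    positivity
  exact mul_le_mul_of_nonneg_right hCC' h0

/-! ## The trivial configuration and the one-point torus -/

/-- The trivial (unit) gauge configuration. -/
def trivialConfig (L : ℕ) : GaugeConfig 4 L SU3 := fun _ => 1

/-- `S_W(U ≡ 1) = 0`. -/
theorem wilsonAction_trivialConfig (L : ℕ) [NeZero L] : wilsonAction ρ₃ (trivialConfig L) = 0 := by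
  simp [wilsonAction, trivialConfig, plaquetteHolonomy, Matrix.trace_one]

/-- On the one-point torus the free Wilson–Dirac operator is the scalar `m`: all hops are on-site and
the Wilson term cancels the `4r` exactly (`r = 1`). -/
theorem wilsonDirac_trivialConfig_one (m : ℝ) :
    wilsonDirac ρ₃ (trivialConfig 1) m 1 = ((m : ℂ)) • (1 : Matrix _ _ ℂ) := by
  ext ⟨x, a, α⟩ ⟨y, b, β⟩
  have hxy : x = y := Subsingleton.elim _ _
  subst hxy
  simp only [wilsonDirac, trivialConfig, Matrix.of_apply, map_one, inv_one, Matrix.smul_apply,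
    Matrix.sub_apply, Matrix.add_apply, Matrix.one_apply, smul_eq_mul,
    eq_iff_true_of_subsingleton, if_true, Prod.mk.injEq, true_and]
  have key : ∀ μ : Fin 4, ((((1:ℝ):ℂ) * if α = β then (1:ℂ) else 0) - euclideanGamma μ α β) *
      (if a = b then (1:ℂ) else 0) +
      ((((1:ℝ):ℂ) * if α = β then (1:ℂ) else 0) + euclideanGamma μ α β) * (if a = b then (1:ℂ) else 0)
      = 2 * ((if α = β then (1:ℂ) else 0) * (if a = b then (1:ℂ) else 0)) := fun μ => by push_cast; ring
  simp only [key, Finset.sum_const, Finset.card_univ, Fintype.card_fin, nsmul_eq_mul]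
  by_cases hab : a = b
  · by_cases hαβ : α = β
    · simp [hab, hαβ]; ring
    · simp [hab, hαβ]
  · simp [hab]

/-- `dim` of the whole quark-field space on the torus of side `L` is `12 L⁴`. -/
theorem finrank_top_quarkFields (L : ℕ) [NeZero L] :
    Module.finrank ℂ (⊤ : Submodule ℂ (TorusSite 4 L × Fin 3 × Fin 4 → ℂ)) = 12 * L ^ 4 := by
  rw [finrank_top, Module.finrank_fintype_fun_eq_card]
  simp [Fintype.card_prod, ZMod.card, Fintype.card_fin]
  ring

/-- The hypothesis of the crux holds on the WHOLE space with `λ = 81`, for every `L`, every SU(3) field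
and every `m ∈ [−1/2, 1]`: `‖D_W(m)‖ ≤ |m + 4| + 4 ≤ 9` (tree: `l2_opNorm_wilsonDirac_le`, HJL (2.14)). -/
theorem hyp_top_81 (L : ℕ) [NeZero L] (U : GaugeConfig 4 L SU3) {m : ℝ}
    (hm : m ∈ Set.Icc (-(1 / 2 : ℝ)) 1) (v : TorusSite 4 L × Fin 3 × Fin 4 → ℂ) :
    ∑ i, ‖(wilsonDirac ρ₃ U m 1).mulVec v i‖ ^ 2 ≤ 81 * ∑ i, ‖v i‖ ^ 2 := by
  refine (sum_norm_sq_mulVec_le _ v).trans ?_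
  have hn := l2_opNorm_wilsonDirac_le ρ₃ fundamentalRep_mem_unitaryGroup U m
  have h9 : ‖wilsonDirac ρ₃ U m 1‖ ≤ 9 := by
    refine hn.trans ?_
    rw [abs_of_pos (by linarith [hm.1])]
    linarith [hm.2]
  have h0 : 0 ≤ ∑ i, ‖v i‖ ^ 2 := Finset.sum_nonneg fun i _ => by positivity
  have : ‖wilsonDirac ρ₃ U m 1‖ ^ 2 ≤ 81 := by nlinarith [norm_nonneg (wilsonDirac ρ₃ U m 1)]
  exact mul_le_mul_of_nonneg_right this h0

/-- On the one-point torus at `m = 0` the hypothesis holds on the whole space with `λ = 0`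
(`D_W = 0` there). -/
theorem hyp_top_zero_one (v : TorusSite 4 1 × Fin 3 × Fin 4 → ℂ) :
    ∑ i, ‖(wilsonDirac ρ₃ (trivialConfig 1) 0 1).mulVec v i‖ ^ 2 ≤ 0 * ∑ i, ‖v i‖ ^ 2 := by
  simp [wilsonDirac_trivialConfig_one]

/-! ## (a) Load-bearing terms of the bound -/

/-- STRENGTHENING (refuted below): the crux `ActionBoundsLowModes` with the additive `+ 1` dropped
(a named variant of a route statement, not a literature fact). -/
def ActionBoundsLowModesWithoutOne : Prop :=
  ∃ C : ℝ, ∀ (L : ℕ) [NeZero L] (U : GaugeConfig 4 L SU3) (m : ℝ), m ∈ Set.Icc (-(1 / 2 : ℝ)) 1 →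
    ∀ (lam : ℝ), 0 ≤ lam → ∀ (E : Submodule ℂ (TorusSite 4 L × Fin 3 × Fin 4 → ℂ)),
      (∀ v ∈ E, ∑ i, ‖(wilsonDirac ρ₃ U m 1).mulVec v i‖ ^ 2 ≤ lam * ∑ i, ‖v i‖ ^ 2) →
        (Module.finrank ℂ E : ℝ) ≤ C * (lam ^ 2 * (L : ℝ) ^ 4 + wilsonAction ρ₃ U)

/-- ANY PROOF MUST USE THE `+ 1`: the 12 constant zero modes of the free massless operator
(here on the `1⁴` torus, where `D_W(U ≡ 1, m = 0) = 0`) have `λ = 0` and `S_W = 0`. -/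
theorem actionBoundsLowModes_false_without_one : ¬ ActionBoundsLowModesWithoutOne := by
  rintro ⟨C, hC⟩
  have h := hC 1 (trivialConfig 1) 0 (by norm_num) 0 le_rfl ⊤ (fun v _ => hyp_top_zero_one v)
  rw [finrank_top_quarkFields, wilsonAction_trivialConfig] at h
  norm_num at h

/-- STRENGTHENING (refuted below): the crux `ActionBoundsLowModes` with the Weyl term `λ² L⁴`
dropped (a named variant of a route statement, not a literature fact). -/
def ActionBoundsLowModesWithoutWeyl : Prop :=
  ∃ C : ℝ, ∀ (L : ℕ) [NeZero L] (U : GaugeConfig 4 L SU3) (m : ℝ), m ∈ Set.Icc (-(1 / 2 : ℝ)) 1 →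
    ∀ (lam : ℝ), 0 ≤ lam → ∀ (E : Submodule ℂ (TorusSite 4 L × Fin 3 × Fin 4 → ℂ)),
      (∀ v ∈ E, ∑ i, ‖(wilsonDirac ρ₃ U m 1).mulVec v i‖ ^ 2 ≤ lam * ∑ i, ‖v i‖ ^ 2) →
        (Module.finrank ℂ E : ℝ) ≤ C * (wilsonAction ρ₃ U + 1)

/-- ANY PROOF MUST USE THE WEYL TERM: with `λ = 81 ≥ ‖D_W‖²` the whole `12L⁴`-dimensional space
qualifies while `S_W(U ≡ 1) = 0`; take `L > C`. -/
theorem actionBoundsLowModes_false_without_weyl : ¬ ActionBoundsLowModesWithoutWeyl := by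
  rintro ⟨C, hC⟩
  obtain ⟨L, hL⟩ := exists_nat_gt C
  have h := hC (L + 1) (trivialConfig (L + 1)) 0 (by norm_num) 81 (by norm_num) ⊤
    (fun v _ => hyp_top_81 (L + 1) (trivialConfig (L + 1)) (by norm_num) v)
  rw [finrank_top_quarkFields, wilsonAction_trivialConfig] at h
  push_cast at h
  have h1 : (1 : ℝ) ≤ (L : ℝ) + 1 := by linarith [(Nat.cast_nonneg L : (0 : ℝ) ≤ L)]
  have h4 : (L : ℝ) + 1 ≤ ((L : ℝ) + 1) ^ 4 := le_self_pow₀ h1 (by norm_num)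
  nlinarith

/-! ## (b) Tightness of the constant -/

/-- Any admissible constant is at least `12` (free constant zero modes on the `1⁴` torus:
`dim = 12`, `λ = 0`, `S_W = 0`). -/
theorem actionBoundsLowModes_twelve_le_const {C : ℝ} (h : ActionBoundsLowModesWith C) : 12 ≤ C := by
  have h1 := h 1 (trivialConfig 1) 0 (by norm_num) 0 le_rfl ⊤ (fun v _ => hyp_top_zero_one v)
  rw [finrank_top_quarkFields, wilsonAction_trivialConfig] at h1
  norm_num at h1
  exact h1

/-- Hence the crux fails for every constant below `12` (a refuted strengthening, not a refutation). -/
theorem actionBoundsLowModes_false_of_const_lt_twelve {C : ℝ} (hC : C < 12) : ¬ ActionBoundsLowModesWith C :=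
  fun h => (lt_irrefl C) (lt_of_lt_of_le hC (actionBoundsLowModes_twelve_le_const h))

end Summit.QuantumFields.QCD.Theorems.ActionBoundsLowModes.Negative
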